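import Mathlib
import HarnessLib
import Literature.AlgebraicGeometry.Resolution.BlowupExceptionalGenericOrder
import Literature.AlgebraicGeometry.Resolution.BlowupExceptionalFibreIrreducible
import Literature.AlgebraicGeometry.Resolution.BlowupDisjointCentreSplitting
import Literature.AlgebraicGeometry.Resolution.BlowupsIntegral
import Literature.AlgebraicGeometry.Resolution.PermissibleCentres

/-!
# Kollár–Szabó going down, blow-up step (K4-η): the generic point of the exceptional fibre of a point
# blow-up is a valuation-ring point (crux `WildQuotients.WildQuotientResolution`, stub `stub_phaseZeroHighDim`)

Crux stmt-ResolutionOfSingularities-15640 (`WildQuotientResolution`), registered stub `stub_phaseZeroHighDim`;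
programme PHASE0-KS-EIGENLINE (hands 8-g0/8-g1/9-g0): discharge the named fact
`Literature.AlgebraicGeometry.GroupActions.KollarSzaboGoingDown` behind ✓p824255. After
✓`KSGoingDown.kollarSzaboGoingDown_of_step` (p828xxx, seat 9-g0) the named fact is reduced to ONE abstract
hypothesis `hstep`: the equivariant point blow-up `b : X̃ → X` with a VALUATION-RING POINT `η ∈ X̃` hit by an
equivariant `E → X̃` carrying an `H`-fixed regular closed point. This file supplies the `η`-half for the tree's
blow-ups (universal property `IsBlowup`, `Blowups.lean`):

* `mem_maxPoints_of_isGenericPoint` — a generic point of a subset is a maximal point of it;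
* `vanishingIdeal_singleton_ne_bot` — the reduced ideal of a closed point of a scheme with another point is
  non-zero (so the point blow-up of an integral positive-dimensional scheme is integral and birational,
  ✓`IsBlowup.isIntegral`, ✓`IsBlowup.isBirational'`);
* `exists_isGenericPoint_valuationRing_stalk` — **for a blowing up `π : X' → X` of an integral locally
  Noetherian scheme along the reduced closed point `{x}`, `𝒪_{X,x}` regular and not a field, the exceptional
  fibre `π⁻¹(x)` is irreducible (✓`IsBlowup.isIrreducible_preimage_singleton`) and the local ring of `X'` at its
  generic point `η` is a discrete valuation ring** (its maximal ideal is generated by a non-zero-divisor,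
  ✓`IsBlowup.exists_uniformizer_of_mem_maxPoints`; Noetherian local domain ⇒ DVR, Mathlib's
  `IsDiscreteValuationRing.TFAE`), in particular a valuation ring — the `η` of `hstep`.

[OURS · crux stmt-ResolutionOfSingularities-15640 · helper toward `stub_phaseZeroHighDim` (one clause of the
abstract blow-up step of Kollár–Szabó going down; NOT a proof of the stub); folklore (Stacks 0804, Hartshorne
II 8.24 (b)), counted 0; AI-level work, weaker than expert review.] [folklore]
-/

-- single-problem summit: the doubled namespace component `ResolutionOfSingularities` is forced
set_option linter.dupNamespace false

noncomputable section

open CategoryTheory CategoryTheory.Limits AlgebraicGeometry TopologicalSpace IsLocalRing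
open Literature.AlgebraicGeometry.Resolution
open Scheme.IdealSheafData

namespace Summit.ResolutionOfSingularities.ResolutionOfSingularities.Theorems.WildQuotientResolution.KSGoingDown

universe u

/-- A generic point of a subset of a scheme is a maximal point of it (schemes are T₀). [folklore] -/
theorem mem_maxPoints_of_isGenericPoint {X : Scheme.{u}} {S : Set X} {η : X} (hη : IsGenericPoint η S) :
    η ∈ maxPoints S := by
  refine ⟨hη.mem, fun η' hη' hs => ?_⟩
  exact (hs.antisymm (hη.specializes hη')).eq

/-- The reduced ideal sheaf of a closed point is non-zero as soon as the scheme has another point (the support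
of `𝓘_{x}` is `{x}`, the support of `⊥` is everything). [folklore] -/
theorem vanishingIdeal_singleton_ne_bot {X : Scheme.{u}} {x : X} (hx : IsClosed ({x} : Set X))
    {y : X} (hy : y ≠ x) : vanishingIdeal ⟨{x}, hx⟩ ≠ ⊥ := by
  intro h
  have := congrArg (fun I : X.IdealSheafData => (I.support : Set X)) h
  simp only [Scheme.IdealSheafData.coe_support_vanishingIdeal, Scheme.IdealSheafData.support_bot,
    Closeds.coe_top] at this
  have hyx : y ∈ ((⟨{x}, hx⟩ : Closeds X) : Set X) := by
    rw [this]
    exact Set.mem_univ _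
  exact hy hyx

/-- A point whose local ring is not a field is not the generic point of an integral scheme; in particular the
scheme has a point different from it. [folklore] -/
theorem genericPoint_ne_of_not_isField {X : Scheme.{u}} [IsIntegral X] {x : X}
    (hx : ¬ IsField (X.presheaf.stalk x)) : genericPoint X ≠ x := by
  intro h
  apply hx
  subst h
  -- the stalk at the generic point is the function field, a field
  exact (inferInstance : Field X.functionField).toIsField

/-- **The generic point of the exceptional fibre of a point blow-up is a valuation-ring point.** For a blowing
up `π : X' → X` (universal property) of an integral locally Noetherian scheme along the reduced closed point
`{x}`, with `𝒪_{X,x}` regular and not a field (so that `X'` is integral, ✓`IsBlowup.isIntegral` with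
`vanishingIdeal_singleton_ne_bot`; taken as an instance hypothesis): there is a point `η ∈ X'` over `x`, the
generic point of the (irreducible) fibre `π⁻¹(x)`, whose local ring `𝒪_{X',η}` is a discrete valuation ring, hence
a valuation ring. [cite: Hartshorne1977, II Thm. 8.24 (b)] -/
theorem exists_isGenericPoint_valuationRing_stalk {X X' : Scheme.{u}} [IsIntegral X] [IsLocallyNoetherian X]
    {π : X' ⟶ X} {x : X} (hx : IsClosed ({x} : Set X)) (hπ : IsBlowup π (vanishingIdeal ⟨{x}, hx⟩))
    [IsRegularLocalRing (X.presheaf.stalk x)] (hnf : ¬ IsField (X.presheaf.stalk x)) [IsIntegral X'] :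
    ∃ η : X', π η = x ∧ IsGenericPoint η (π ⁻¹' {x}) ∧
      IsDiscreteValuationRing (X'.presheaf.stalk η) ∧ ValuationRing (X'.presheaf.stalk η) := by
  have hne : maximalIdeal (X.presheaf.stalk x) ≠ ⊥ := fun h =>
    hnf (IsLocalRing.isField_iff_maximalIdeal_eq.mpr h)
  -- the fibre is irreducible and closed; take its generic point
  have hirr : IsIrreducible (π ⁻¹' {x}) :=
    hπ.isIrreducible_preimage_singleton x (stalkIdeal_vanishingIdeal_singleton hx) hne
  have hcl : IsClosed (π ⁻¹' {x}) := hx.preimage π.continuous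
  obtain ⟨η, hη⟩ : ∃ η : X', IsGenericPoint η (π ⁻¹' {x}) :=
    ⟨hirr.genericPoint, hirr.isGenericPoint_genericPoint hcl⟩
  have hηx : π η = x := hη.mem
  refine ⟨η, hηx, hη, ?_⟩
  -- Noetherianity of `X'`
  haveI : IsLocallyNoetherian X' := hπ.isLocallyNoetherian
  -- the uniformizer at the maximal point `η` of `π⁻¹({x})`
  subst hηx
  have hmax : η ∈ maxPoints (π ⁻¹' (((⟨{π η}, hx⟩ : Closeds X) : Set X))) :=
    mem_maxPoints_of_isGenericPoint hη
  obtain ⟨t, ht0, hmt, -, -, -⟩ :=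
    hπ.exists_uniformizer_of_mem_maxPoints hmax (stalkIdeal_vanishingIdeal_singleton hx)
  -- a Noetherian local domain whose maximal ideal is principal and non-zero is a DVR
  have hnf' : ¬ IsField (X'.presheaf.stalk η) := by
    intro hf
    have hbot := IsLocalRing.isField_iff_maximalIdeal_eq.mp hf
    rw [hmt, Ideal.span_singleton_eq_bot] at hbot
    exact nonZeroDivisors.ne_zero ht0 hbot
  have hprinc : (maximalIdeal (X'.presheaf.stalk η)).IsPrincipal := ⟨⟨t, hmt⟩⟩
  have tfae := IsDiscreteValuationRing.TFAE (X'.presheaf.stalk η) hnf'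
  exact ⟨(tfae.out 0 4).mpr hprinc, (tfae.out 1 4).mpr hprinc⟩

end Summit.ResolutionOfSingularities.ResolutionOfSingularities.Theorems.WildQuotientResolution.KSGoingDown

end
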